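import Summits.ABC.StewartYu.ArchG3Functions
import Summits.ABC.StewartYu.ArchG3JetsCore
import HarnessLib

/-!
# Cell abc-stewartyu, rung A1.L (crux r2 `ArchCoreRat`), parcel WP-L.A P-A4: ARCHIMEDEAN SIZES of the Gen-3 class functions — growth on a
# disc (plain and twisted), the `f − φ` comparison, the sizes of the monomials `∏ αⱼ^{wⱼ x}`, the directional coefficients on a box,
# and the Taylor-normalised jets of `f_τ` from the value envelope

`Summits/ABC/StewartYu/ArchG3Sizes.lean` — sequel to `ArchG3Functions` / `ArchG3JetsCore` (cell `abc-stewartyu`, seat p5-g7; tranche plan §4′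
P-A4: «Lemma 3.10 / 3.11, (4.15)–(4.17), (4.27)–(4.28)»).  Theorems on `ArchG3Setup`; no named fact, no parameters (the record `ArchG3Par`
supplies numbers).  Archimedean twin of `PadicG3FunctionsB.norm_g3F_le_of_node` / `norm_g3F_sub_g3Φ_le` and of the `Bw`-type supplies, with
the one genuinely archimedean phenomenon made explicit: the functions GROW on the disc `|z| ≤ ρ` like `exp(ρ·|E(vᵢ)|)`, so every bound
carries the factor `exp(ρ·Emax)` (Nesterenko (4.27): on a slab of width `w` with relative exponents, `Emax ≤ w + V₀·|Λ/b_{j₀}|`,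
`ArchG3Setup.abs_E_sub_le_of_slab'`), or `exp(ρ·max|E(vᵢ) − γ|)` after the twist `e^{−γz}` of design B.

* `norm_exp_real_mul_le` (`|e^{cz}| ≤ e^{|c|·|z|}`), `norm_archTermF_le`, **`norm_exp_mul_archF_le_of_disc`** (twisted growth:
  `‖e^{−γz} f_τ(z)‖ ≤ #B·P·W·∏Γₖ^{tₖ}·e^{ρ·Emax}` for `|z| ≤ ρ`, `|pᵢ| ≤ P`, `|Hasse_{t₀}Rᵢ(z)| ≤ W`, `|zγ(vᵢ)ₖ| ≤ Γₖ`, `|E(vᵢ) − γ| ≤ Emax`)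
  and the plain case **`norm_archF_le_of_disc`** (`γ = 0`) — Nesterenko (4.28) in the frame's currencies;
* **`norm_archF_sub_archΦ_le`** (complex point, `|z| ≤ ρ`) and **`norm_archF_sub_archφ_le_intCast`** (integer node): the `f − φ` comparison
  `≤ #B·P·W·∏Γ^{t}·e^{ρ·Lmax}·(2·V₀·|Λ/b_{j₀}|·ρ)` when `V₀·|Λ/b_{j₀}|·ρ ≤ 1` (print (2.5)/(4.15)–(4.16): `|e^δ − 1| ≤ 2|δ|`);
* `prod_zpow_eq_exp_Lsum`, `prod_zpow_le_exp`, `exp_neg_le_prod_zpow` — the archimedean size of the monomial `∏ αⱼ^{wⱼ}`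
  (`e^{∓Σ|wⱼ|Aⱼ}`; Lemma 3.11 is the height version, for which see `MonomialDen.log_monDen_le` / `exists_int_monDen_mul_prod_zpow`);
* `abs_zγ_mul_lg_le_of_box` — `|zγ(w)ₖ|·|log αₖ| ≤ Aₖ(Lₖ + |bₖ/b_{j₀}|·L_{j₀})` on the box (print's `|xₖ| ≤ BL`, (4.22));
* **`norm_iteratedDeriv_archF_le_jetMaj`** — the instantiation of `ArchJets.norm_iteratedDeriv_le_jetMaj` (`c τ 0 = t₀+1`, `ℓₖ = Aₖ ≥ |log αₖ|`),
  and **`archF_envelope_of_vanishing`** — at an integer node where the rational values `archφ τ′ x` vanish for `|τ′| ≤ N`, the `f − φ`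
  comparison IS the value envelope `‖f_τ′(x)‖ ≤ ε·∏Γ^{t′}` with `ε = #B·P·W·e^{|x|·Lmax}·2V₀|Λ/b_{j₀}||x|` (`Θ = 1`).

WHAT THIS IS NOT: no Hermite / Cauchy step and no Liouville conclusion (lp-1's `ArchG3KStep*`); no parameters; no crux moves.

References: Yu. V. Nesterenko, LNM 1819 (2003), §2 (2.5), Lemma 3.10, Lemma 3.11, §4.2 (4.15)–(4.17), (4.22), (4.27)–(4.28).
-/

noncomputable section

open Finset Polynomial
open Literature.NumberTheory.Transcendental
open Literature.NumberTheory.Transcendental.CW77.Setup (Tau tauNorm bumpτ tauNorm_bumpτ)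
open Summit.ABC.StewartYu.ArchJets (jetMaj env norm_iteratedDeriv_le_jetMaj)
open scoped Nat

namespace Summit.ABC.StewartYu

namespace ArchG3Setup

variable (S : ArchG3Setup) {ι : Type*} (R : ι → ℚ[X]) (v : ι → Fin S.n → ℤ)

/-! ### Growth of the exponentials -/

/-- `‖exp(c·z)‖ ≤ exp(|c|·‖z‖)` for a real frequency `c`. [folklore] -/
theorem norm_exp_real_mul_le (c : ℝ) (z : ℂ) : ‖Complex.exp ((c : ℂ) * z)‖ ≤ Real.exp (|c| * ‖z‖) := by
  rw [Complex.norm_exp]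
  refine Real.exp_le_exp.mpr ?_
  calc ((c : ℂ) * z).re ≤ ‖(c : ℂ) * z‖ := Complex.re_le_norm _
    _ = |c| * ‖z‖ := by rw [norm_mul, Complex.norm_real, Real.norm_eq_abs]

/-- `‖exp(c·z)‖ ≤ exp(C·ρ)` when `|c| ≤ C`, `‖z‖ ≤ ρ`. [folklore] -/
theorem norm_exp_real_mul_le_of_le {c C ρ : ℝ} {z : ℂ} (hc : |c| ≤ C) (hz : ‖z‖ ≤ ρ) :
    ‖Complex.exp ((c : ℂ) * z)‖ ≤ Real.exp (C * ρ) :=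
  (norm_exp_real_mul_le c z).trans (Real.exp_le_exp.mpr
    (mul_le_mul hc hz (norm_nonneg _) ((abs_nonneg _).trans hc)))

/-- At a real point the exact exponential is the positive real `e^{x·Lsum}`: `‖exp(Lsum·x)‖ = exp(Lsum·x)`. [folklore] -/
theorem norm_exp_Lc_mul_real (w : Fin S.n → ℤ) (x : ℝ) :
    ‖Complex.exp (S.Lc w * (x : ℂ))‖ = Real.exp (S.Lsum w * x) := by
  unfold Lc
  rw [← Complex.ofReal_mul, Complex.norm_exp_ofReal]

/-! ### Growth of the class functions on a disc -/

/-- One twisted term: `‖e^{−γz}·archTermF i τ z‖ ≤ ‖hw_i(z)‖·|zγpow|·exp(|E(vᵢ) − γ|·‖z‖)`. [cite: Nesterenko2003, §4.2 (4.27)] -/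
theorem norm_exp_mul_archTermF_le (γ : ℝ) (i : ι) (τ : Tau S.n) (z : ℂ) :
    ‖Complex.exp (-(γ : ℂ) * z) * S.archTermF R v i τ z‖ ≤
      ‖(hw R i τ.1).eval z‖ * |(S.zγpow v i τ.2 : ℝ)| * Real.exp (|S.E (v i) - γ| * ‖z‖) := by
  have hexp : Complex.exp (-(γ : ℂ) * z) * Complex.exp (S.Ec (v i) * z) = Complex.exp (((S.E (v i) - γ : ℝ) : ℂ) * z) := by
    rw [← Complex.exp_add]; unfold Ec; push_cast; ring_nf
  have hq : ‖((S.zγpow v i τ.2 : ℚ) : ℂ)‖ = |(S.zγpow v i τ.2 : ℝ)| := by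
    rw [← Complex.ofReal_ratCast, Complex.norm_real, Real.norm_eq_abs]
  calc ‖Complex.exp (-(γ : ℂ) * z) * S.archTermF R v i τ z‖
      = ‖(hw R i τ.1).eval z * ((S.zγpow v i τ.2 : ℚ) : ℂ) * Complex.exp (((S.E (v i) - γ : ℝ) : ℂ) * z)‖ := by
        simp only [archTermF]; rw [← hexp]; ring_nf
    _ = ‖(hw R i τ.1).eval z‖ * |(S.zγpow v i τ.2 : ℝ)| * ‖Complex.exp (((S.E (v i) - γ : ℝ) : ℂ) * z)‖ := by
        rw [norm_mul, norm_mul, hq]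
    _ ≤ ‖(hw R i τ.1).eval z‖ * |(S.zγpow v i τ.2 : ℝ)| * Real.exp (|S.E (v i) - γ| * ‖z‖) :=
        mul_le_mul_of_nonneg_left (norm_exp_real_mul_le _ z) (by positivity)

/-- **Twisted growth on a disc** (design B): for `‖z‖ ≤ ρ`, `|pᵢ| ≤ P`, `‖(Hasse_{t₀}Rᵢ)(z)‖ ≤ W`, `|zγ(vᵢ)ₖ| ≤ Γₖ` and `|E(vᵢ) − γ| ≤ Emax`
on `B`:  `‖e^{−γz}·f_τ(z)‖ ≤ #B·P·W·(∏ₖ Γₖ^{tₖ})·exp(Emax·ρ)`. [cite: Nesterenko2003, Lemma 3.10 and §4.2 (4.27)–(4.28)] -/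
theorem norm_exp_mul_archF_le_of_disc (γ : ℝ) (B : Finset ι) (pv : ι → ℤ) (τ : Tau S.n) {z : ℂ} {ρ : ℝ} (hz : ‖z‖ ≤ ρ)
    {P W Emax : ℝ} {Γ : Fin S.n → ℝ} (hP : ∀ i ∈ B, |(pv i : ℝ)| ≤ P) (hW : ∀ i ∈ B, ‖(hw R i τ.1).eval z‖ ≤ W)
    (hΓ : ∀ i ∈ B, ∀ k, |(S.zγ (v i) k : ℝ)| ≤ Γ k) (hE : ∀ i ∈ B, |S.E (v i) - γ| ≤ Emax) :
    ‖Complex.exp (-(γ : ℂ) * z) * S.archF R v B pv τ z‖ ≤ B.card * P * W * (∏ k, Γ k ^ τ.2 k) * Real.exp (Emax * ρ) := by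
  unfold archF
  rw [mul_sum]
  have hterm : ∀ i ∈ B, ‖Complex.exp (-(γ : ℂ) * z) * ((pv i : ℂ) * S.archTermF R v i τ z)‖ ≤
      P * W * (∏ k, Γ k ^ τ.2 k) * Real.exp (Emax * ρ) := by
    intro i hi
    have hP0 : 0 ≤ P := (abs_nonneg _).trans (hP i hi)
    have hW0 : 0 ≤ W := (norm_nonneg _).trans (hW i hi)
    have hΓ0 : ∀ k, 0 ≤ Γ k := fun k => (abs_nonneg _).trans (hΓ i hi k)
    have h1 := S.norm_exp_mul_archTermF_le R v γ i τ z
    have hpow := S.abs_zγpow_le v i τ.2 (hΓ i hi)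
    have hex : Real.exp (|S.E (v i) - γ| * ‖z‖) ≤ Real.exp (Emax * ρ) :=
      Real.exp_le_exp.mpr (mul_le_mul (hE i hi) hz (norm_nonneg _) ((abs_nonneg _).trans (hE i hi)))
    have hpv : ‖(pv i : ℂ)‖ = |(pv i : ℝ)| := by rw [← Complex.ofReal_intCast, Complex.norm_real, Real.norm_eq_abs]
    calc ‖Complex.exp (-(γ : ℂ) * z) * ((pv i : ℂ) * S.archTermF R v i τ z)‖
        = ‖(pv i : ℂ)‖ * ‖Complex.exp (-(γ : ℂ) * z) * S.archTermF R v i τ z‖ := by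
          rw [← norm_mul]; ring_nf
      _ ≤ P * (‖(hw R i τ.1).eval z‖ * |(S.zγpow v i τ.2 : ℝ)| * Real.exp (|S.E (v i) - γ| * ‖z‖)) := by
          rw [hpv]; exact mul_le_mul (hP i hi) h1 (norm_nonneg _) hP0
      _ ≤ P * (W * (∏ k, Γ k ^ τ.2 k) * Real.exp (Emax * ρ)) := by
          refine mul_le_mul_of_nonneg_left ?_ hP0
          exact mul_le_mul (mul_le_mul (hW i hi) hpow (abs_nonneg _) hW0) hex (by positivity)
            (mul_nonneg hW0 (prod_nonneg fun k _ => pow_nonneg (hΓ0 k) _))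
      _ = P * W * (∏ k, Γ k ^ τ.2 k) * Real.exp (Emax * ρ) := by ring
  calc ‖∑ i ∈ B, Complex.exp (-(γ : ℂ) * z) * ((pv i : ℂ) * S.archTermF R v i τ z)‖
      ≤ ∑ i ∈ B, ‖Complex.exp (-(γ : ℂ) * z) * ((pv i : ℂ) * S.archTermF R v i τ z)‖ := norm_sum_le _ _
    _ ≤ ∑ i ∈ B, P * W * (∏ k, Γ k ^ τ.2 k) * Real.exp (Emax * ρ) := sum_le_sum hterm
    _ = B.card * P * W * (∏ k, Γ k ^ τ.2 k) * Real.exp (Emax * ρ) := by rw [sum_const, nsmul_eq_mul]; ring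

/-- **Plain growth on a disc**: for `‖z‖ ≤ ρ` and `|E(vᵢ)| ≤ Emax` on `B`, `‖f_τ(z)‖ ≤ #B·P·W·(∏ₖ Γₖ^{tₖ})·exp(Emax·ρ)`.
[cite: Nesterenko2003, Lemma 3.10 and §4.2 (4.28)] -/
theorem norm_archF_le_of_disc (B : Finset ι) (pv : ι → ℤ) (τ : Tau S.n) {z : ℂ} {ρ : ℝ} (hz : ‖z‖ ≤ ρ)
    {P W Emax : ℝ} {Γ : Fin S.n → ℝ} (hP : ∀ i ∈ B, |(pv i : ℝ)| ≤ P) (hW : ∀ i ∈ B, ‖(hw R i τ.1).eval z‖ ≤ W)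
    (hΓ : ∀ i ∈ B, ∀ k, |(S.zγ (v i) k : ℝ)| ≤ Γ k) (hE : ∀ i ∈ B, |S.E (v i)| ≤ Emax) :
    ‖S.archF R v B pv τ z‖ ≤ B.card * P * W * (∏ k, Γ k ^ τ.2 k) * Real.exp (Emax * ρ) := by
  have h := S.norm_exp_mul_archF_le_of_disc R v 0 B pv τ hz hP hW hΓ (fun i hi => by rw [sub_zero]; exact hE i hi)
  simpa using h

/-! ### The `f − φ` comparison -/

/-- `‖exp(δ·z) − 1‖ ≤ 2·|δ|·ρ` for a real `δ` with `|δ|·ρ ≤ 1`, `‖z‖ ≤ ρ`. [cite: Nesterenko2003, §2 (2.5)] -/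
theorem norm_exp_real_mul_sub_one_le {δ ρ : ℝ} {z : ℂ} (hz : ‖z‖ ≤ ρ) (hδ : |δ| * ρ ≤ 1) :
    ‖Complex.exp ((δ : ℂ) * z) - 1‖ ≤ 2 * (|δ| * ρ) := by
  have hn : ‖(δ : ℂ) * z‖ ≤ |δ| * ρ := by
    rw [norm_mul, Complex.norm_real, Real.norm_eq_abs]
    exact mul_le_mul_of_nonneg_left hz (abs_nonneg _)
  exact (Complex.norm_exp_sub_one_le (hn.trans hδ)).trans (by linarith)

/-- **The `f − φ` comparison on a disc**: for `‖z‖ ≤ ρ`, `|pᵢ| ≤ P`, `‖(Hasse_{t₀}Rᵢ)(z)‖ ≤ W`, `|zγ(vᵢ)ₖ| ≤ Γₖ`, `|Lsum(vᵢ)| ≤ Lmax`,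
`|vᵢ,j₀| ≤ V₀` on `B`, and `V₀·|Λ/b_{j₀}|·ρ ≤ 1`:
`‖f_τ(z) − φ_τ(z)‖ ≤ #B·P·W·(∏ₖ Γₖ^{tₖ})·exp(Lmax·ρ)·(2·V₀·|Λ/b_{j₀}|·ρ)`. [cite: Nesterenko2003, §4.2 (4.15)–(4.16)] -/
theorem norm_archF_sub_archΦ_le (B : Finset ι) (pv : ι → ℤ) (τ : Tau S.n) {z : ℂ} {ρ : ℝ} (hz : ‖z‖ ≤ ρ)
    {P W Lmax V₀ : ℝ} {Γ : Fin S.n → ℝ} (hP : ∀ i ∈ B, |(pv i : ℝ)| ≤ P) (hW : ∀ i ∈ B, ‖(hw R i τ.1).eval z‖ ≤ W)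
    (hΓ : ∀ i ∈ B, ∀ k, |(S.zγ (v i) k : ℝ)| ≤ Γ k) (hL : ∀ i ∈ B, |S.Lsum (v i)| ≤ Lmax)
    (hV₀ : ∀ i ∈ B, |(v i S.j₀ : ℝ)| ≤ V₀) (hsmall : V₀ * |S.Λ / (S.b S.j₀ : ℝ)| * ρ ≤ 1) :
    ‖S.archF R v B pv τ z - S.archΦ R v B pv τ z‖ ≤
      B.card * P * W * (∏ k, Γ k ^ τ.2 k) * Real.exp (Lmax * ρ) * (2 * (V₀ * |S.Λ / (S.b S.j₀ : ℝ)| * ρ)) := by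
  rw [S.archF_sub_archΦ]
  set δ₀ : ℝ := |S.Λ / (S.b S.j₀ : ℝ)| with hδ₀
  have hρ0 : 0 ≤ ρ := (norm_nonneg _).trans hz
  have hterm : ∀ i ∈ B, ‖(pv i : ℂ) * S.archTermΦ R v i τ z * (Complex.exp (((S.pert (v i) : ℝ) : ℂ) * z) - 1)‖ ≤
      P * W * (∏ k, Γ k ^ τ.2 k) * Real.exp (Lmax * ρ) * (2 * (V₀ * δ₀ * ρ)) := by
    intro i hi
    have hP0 : 0 ≤ P := (abs_nonneg _).trans (hP i hi)
    have hW0 : 0 ≤ W := (norm_nonneg _).trans (hW i hi)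
    have hV0 : 0 ≤ V₀ := (abs_nonneg _).trans (hV₀ i hi)
    have hΓ0 : ∀ k, 0 ≤ Γ k := fun k => (abs_nonneg _).trans (hΓ i hi k)
    -- the perturbation of the index `i`
    have hpert : |S.pert (v i)| ≤ V₀ * δ₀ := by
      rw [S.abs_pert]; exact mul_le_mul_of_nonneg_right (hV₀ i hi) (abs_nonneg _)
    have hpert1 : |S.pert (v i)| * ρ ≤ 1 := (mul_le_mul_of_nonneg_right hpert hρ0).trans hsmall
    have hexp1 : ‖Complex.exp (((S.pert (v i) : ℝ) : ℂ) * z) - 1‖ ≤ 2 * (V₀ * δ₀ * ρ) :=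
      (norm_exp_real_mul_sub_one_le hz hpert1).trans (by nlinarith [mul_le_mul_of_nonneg_right hpert hρ0])
    -- the size of the exact term
    have hq : ‖((S.zγpow v i τ.2 : ℚ) : ℂ)‖ = |(S.zγpow v i τ.2 : ℝ)| := by
      rw [← Complex.ofReal_ratCast, Complex.norm_real, Real.norm_eq_abs]
    have hpv : ‖(pv i : ℂ)‖ = |(pv i : ℝ)| := by rw [← Complex.ofReal_intCast, Complex.norm_real, Real.norm_eq_abs]
    have hΦ : ‖S.archTermΦ R v i τ z‖ ≤ W * (∏ k, Γ k ^ τ.2 k) * Real.exp (Lmax * ρ) := by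
      unfold archTermΦ Lc
      rw [norm_mul, norm_mul, hq]
      exact mul_le_mul (mul_le_mul (hW i hi) (S.abs_zγpow_le v i τ.2 (hΓ i hi)) (abs_nonneg _) hW0)
        (norm_exp_real_mul_le_of_le (hL i hi) hz) (norm_nonneg _)
        (mul_nonneg hW0 (prod_nonneg fun k _ => pow_nonneg (hΓ0 k) _))
    rw [norm_mul, norm_mul, hpv]
    calc |(pv i : ℝ)| * ‖S.archTermΦ R v i τ z‖ * ‖Complex.exp (((S.pert (v i) : ℝ) : ℂ) * z) - 1‖
        ≤ P * (W * (∏ k, Γ k ^ τ.2 k) * Real.exp (Lmax * ρ)) * (2 * (V₀ * δ₀ * ρ)) :=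
          mul_le_mul (mul_le_mul (hP i hi) hΦ (norm_nonneg _) hP0) hexp1 (norm_nonneg _)
            (mul_nonneg hP0 (mul_nonneg (mul_nonneg hW0 (prod_nonneg fun k _ => pow_nonneg (hΓ0 k) _)) (Real.exp_nonneg _)))
      _ = _ := by ring
  calc ‖∑ i ∈ B, (pv i : ℂ) * S.archTermΦ R v i τ z * (Complex.exp (((S.pert (v i) : ℝ) : ℂ) * z) - 1)‖
      ≤ ∑ i ∈ B, ‖(pv i : ℂ) * S.archTermΦ R v i τ z * (Complex.exp (((S.pert (v i) : ℝ) : ℂ) * z) - 1)‖ := norm_sum_le _ _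
    _ ≤ ∑ i ∈ B, P * W * (∏ k, Γ k ^ τ.2 k) * Real.exp (Lmax * ρ) * (2 * (V₀ * δ₀ * ρ)) := sum_le_sum hterm
    _ = _ := by rw [sum_const, nsmul_eq_mul]; ring

/-- **The `f − φ` comparison at an integer node** `x` (where `φ_τ(x) = archφ τ x ∈ ℚ`): under the same uniform data with `ρ = |x|`,
`‖f_τ(x) − archφ τ x‖ ≤ #B·P·W·(∏ₖ Γₖ^{tₖ})·exp(Lmax·|x|)·(2·V₀·|Λ/b_{j₀}|·|x|)`. [cite: Nesterenko2003, §4.2 (4.16), Lemma 4.3] -/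
theorem norm_archF_sub_archφ_le_intCast (B : Finset ι) (pv : ι → ℤ) (τ : Tau S.n) (x : ℤ)
    {P W Lmax V₀ : ℝ} {Γ : Fin S.n → ℝ} (hP : ∀ i ∈ B, |(pv i : ℝ)| ≤ P)
    (hW : ∀ i ∈ B, |(((hasseDeriv τ.1 (R i)).eval (x : ℚ) : ℚ) : ℝ)| ≤ W)
    (hΓ : ∀ i ∈ B, ∀ k, |(S.zγ (v i) k : ℝ)| ≤ Γ k) (hL : ∀ i ∈ B, |S.Lsum (v i)| ≤ Lmax)
    (hV₀ : ∀ i ∈ B, |(v i S.j₀ : ℝ)| ≤ V₀) (hsmall : V₀ * |S.Λ / (S.b S.j₀ : ℝ)| * |(x : ℝ)| ≤ 1) :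
    ‖S.archF R v B pv τ (x : ℂ) - ((S.archφ R v B pv τ x : ℚ) : ℂ)‖ ≤
      B.card * P * W * (∏ k, Γ k ^ τ.2 k) * Real.exp (Lmax * |(x : ℝ)|) * (2 * (V₀ * |S.Λ / (S.b S.j₀ : ℝ)| * |(x : ℝ)|)) := by
  rw [← S.archΦ_intCast]
  have hz : ‖((x : ℤ) : ℂ)‖ ≤ |(x : ℝ)| := by rw [← Complex.ofReal_intCast, Complex.norm_real, Real.norm_eq_abs]
  refine S.norm_archF_sub_archΦ_le R v B pv τ hz hP (fun i hi => ?_) hΓ hL hV₀ hsmall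
  rw [hw_eval_intCast, ← Complex.ofReal_ratCast, Complex.norm_real, Real.norm_eq_abs]
  exact hW i hi

/-! ### The archimedean size of the monomials `∏ αⱼ^{wⱼ}` -/

/-- `∏ⱼ αⱼ^{wⱼ} = exp(Lsum w)` (real). [cite: Nesterenko2003, §3.5 (Lemma 3.11)] -/
theorem prod_zpow_eq_exp_Lsum (w : Fin S.n → ℤ) : ∏ j, (S.α j : ℝ) ^ w j = Real.exp (S.Lsum w) := by
  have h := S.exp_intCast_mul_Lsum w 1
  push_cast at h
  rw [one_mul] at h
  rw [h]
  exact prod_congr rfl fun j _ => by rw [mul_one]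

/-- **`∏ⱼ αⱼ^{wⱼ} ≤ exp(Σⱼ |wⱼ|·Aⱼ)`** when `|log αⱼ| ≤ Aⱼ`. [cite: Nesterenko2003, §3.5 (Lemma 3.11)] -/
theorem prod_zpow_le_exp {A : Fin S.n → ℝ} (hA : ∀ j, |S.lg j| ≤ A j) (w : Fin S.n → ℤ) :
    ∏ j, (S.α j : ℝ) ^ w j ≤ Real.exp (∑ j, |(w j : ℝ)| * A j) := by
  rw [S.prod_zpow_eq_exp_Lsum]
  exact Real.exp_le_exp.mpr ((le_abs_self _).trans (S.abs_Lsum_le hA w))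

/-- **`exp(−Σⱼ |wⱼ|·Aⱼ) ≤ ∏ⱼ αⱼ^{wⱼ}`** when `|log αⱼ| ≤ Aⱼ` (the monomial is not too small either). [cite: Nesterenko2003, §3.5 (Lemma 3.11)] -/
theorem exp_neg_le_prod_zpow {A : Fin S.n → ℝ} (hA : ∀ j, |S.lg j| ≤ A j) (w : Fin S.n → ℤ) :
    Real.exp (-(∑ j, |(w j : ℝ)| * A j)) ≤ ∏ j, (S.α j : ℝ) ^ w j := by
  rw [S.prod_zpow_eq_exp_Lsum]
  exact Real.exp_le_exp.mpr ((neg_le_neg (S.abs_Lsum_le hA w)).trans (neg_abs_le _))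

/-- On the box `|wⱼ| ≤ Lⱼ`: `∏ⱼ αⱼ^{wⱼ x} ≤ exp(|x|·Σⱼ Lⱼ·Aⱼ)` (Matveev's box `Lⱼ = L/(2Aⱼ)` gives Nesterenko's `e^{nL|x|/2}`).
[cite: Nesterenko2003, §3.5 (Lemma 3.11, (3.42))] -/
theorem prod_zpow_mul_le_exp_of_box {A : Fin S.n → ℝ} (hA : ∀ j, |S.lg j| ≤ A j) {L : Fin S.n → ℕ} {w : Fin S.n → ℤ}
    (hw : ∀ j, |w j| ≤ (L j : ℤ)) (x : ℤ) :
    ∏ j, (S.α j : ℝ) ^ (w j * x) ≤ Real.exp (|(x : ℝ)| * ∑ j, (L j : ℝ) * A j) := by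
  refine (S.prod_zpow_le_exp hA _).trans (Real.exp_le_exp.mpr ?_)
  rw [mul_sum]
  refine sum_le_sum fun j _ => ?_
  have h0 : 0 ≤ A j := (abs_nonneg _).trans (hA j)
  have hj : |(w j : ℝ)| ≤ (L j : ℝ) := by exact_mod_cast hw j
  push_cast
  rw [abs_mul]
  calc |(w j : ℝ)| * |(x : ℝ)| * A j = |(x : ℝ)| * (|(w j : ℝ)| * A j) := by ring
    _ ≤ |(x : ℝ)| * ((L j : ℝ) * A j) :=
        mul_le_mul_of_nonneg_left (mul_le_mul_of_nonneg_right hj h0) (abs_nonneg _)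

/-! ### The directional coefficients against the logarithms -/

/-- **`|zγ(w)ₖ|·|log αₖ| ≤ Aₖ·(Lₖ + |bₖ/b_{j₀}|·L_{j₀})`** on the box `|wⱼ| ≤ Lⱼ` when `|log αₖ| ≤ Aₖ` — the summands of the jets
majorant's `y = Σₖ Γₖ·ℓₖ`; with Matveev's box `Lⱼ = L/(2Aⱼ)` and the pivot of maximal weight this is print's `|xₖ|/|bₙ| ≤ BL`.
[cite: Nesterenko2003, §4.2 (4.22)] -/
theorem abs_zγ_mul_lg_le_of_box {A : Fin S.n → ℝ} (hA : ∀ j, |S.lg j| ≤ A j) {L : Fin S.n → ℕ} {w : Fin S.n → ℤ}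
    (hw : ∀ j, |w j| ≤ (L j : ℤ)) (k : Fin S.n) :
    |(S.zγ w k : ℝ)| * |S.lg k| ≤ A k * ((L k : ℝ) + |(S.b k : ℝ) / (S.b S.j₀ : ℝ)| * (L S.j₀ : ℝ)) := by
  have h1 := S.abs_zγ_le_of_box hw k
  have h0 : 0 ≤ A k := (abs_nonneg _).trans (hA k)
  calc |(S.zγ w k : ℝ)| * |S.lg k| ≤ ((L k : ℝ) + |(S.b k : ℝ) / (S.b S.j₀ : ℝ)| * (L S.j₀ : ℝ)) * A k :=
        mul_le_mul h1 (hA k) (abs_nonneg _) (by positivity)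
    _ = _ := by ring

/-! ### The Taylor-normalised jets of `f_τ` -/

/-- **The jets of `f_τ` from the value envelope** (instantiation of `ArchJets.norm_iteratedDeriv_le_jetMaj` with `c τ 0 = t₀ + 1`,
`ℓₖ = Aₖ ≥ |log αₖ|`): if `‖f_τ′(a)‖ ≤ ε·Θ^{t′₀}·∏ₖ Γₖ^{t′ₖ}` for `|τ′| ≤ N` (`Θ, Γₖ ≥ 0`) then for `|τ| + t ≤ N`
`‖f_τ^{(t)}(a)‖ ≤ t!·(ε·Θ^{t₀}∏ₖΓₖ^{tₖ})·jetMaj Θ (Σₖ AₖΓₖ) t₀ t` (and `jetMaj ≤ 2^{t₀+t} max(1,Θ)^t c^t e^{ΣAₖΓₖ/c}`, `ArchJets.jetMaj_le_scaled`).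
[cite: Nesterenko2003, §4.2 Lemma 4.3, (4.19)–(4.22)] -/
theorem norm_iteratedDeriv_archF_le_jetMaj (B : Finset ι) (pv : ι → ℤ) {A : Fin S.n → ℝ} (hA : ∀ k, |S.lg k| ≤ A k)
    {Θ : ℝ} {Γ : Fin S.n → ℝ} (hΘ : 0 ≤ Θ) (hΓ : ∀ k, 0 ≤ Γ k) (a : ℂ) (N : ℕ) {ε : ℝ}
    (hval : ∀ τ : Tau S.n, tauNorm τ ≤ N → ‖S.archF R v B pv τ a‖ ≤ ε * env Θ Γ τ) :
    ∀ (t : ℕ) (τ : Tau S.n), tauNorm τ + t ≤ N →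
      ‖iteratedDeriv t (S.archF R v B pv τ) a‖ ≤ (t ! : ℝ) * (ε * env Θ Γ τ) * jetMaj Θ (∑ k, A k * Γ k) τ.1 t :=
  norm_iteratedDeriv_le_jetMaj (fun τ => S.archF R v B pv τ) S.archCoef (S.differentiable_archF R v B pv)
    (fun τ z => by rw [S.deriv_archF R v B pv τ])
    hΘ (fun k => (abs_nonneg _).trans (hA k)) hΓ (fun τ => by rw [S.norm_archCoef_zero])
    (fun τ k => by rw [S.norm_archCoef_succ]; exact hA k) a N hval

/-- **The value envelope at an integer node from the vanishing of the rational values** (`Θ = 1`): if `archφ τ′ x = 0` for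
`|τ′| ≤ N`, the `Y₀`-weights are uniformly bounded there (`|(Hasse_{t₀}Rᵢ)(x)| ≤ W` for all `t₀ ≤ N`) and the uniform data of
`norm_archF_sub_archφ_le_intCast` hold, then `‖f_τ′(x)‖ ≤ ε·∏ₖΓₖ^{t′ₖ}` with `ε = #B·P·W·e^{Lmax|x|}·(2V₀|Λ/b_{j₀}||x|)` for `|τ′| ≤ N`.
[cite: Nesterenko2003, §4.2 (4.21)–(4.22)] -/
theorem archF_envelope_of_vanishing (B : Finset ι) (pv : ι → ℤ) (x : ℤ) (N : ℕ)
    (hvan : ∀ τ : Tau S.n, tauNorm τ ≤ N → S.archφ R v B pv τ x = 0)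
    {P W Lmax V₀ : ℝ} {Γ : Fin S.n → ℝ} (hP : ∀ i ∈ B, |(pv i : ℝ)| ≤ P)
    (hW : ∀ i ∈ B, ∀ t₀ ≤ N, |(((hasseDeriv t₀ (R i)).eval (x : ℚ) : ℚ) : ℝ)| ≤ W)
    (hΓ : ∀ i ∈ B, ∀ k, |(S.zγ (v i) k : ℝ)| ≤ Γ k) (hL : ∀ i ∈ B, |S.Lsum (v i)| ≤ Lmax)
    (hV₀ : ∀ i ∈ B, |(v i S.j₀ : ℝ)| ≤ V₀) (hsmall : V₀ * |S.Λ / (S.b S.j₀ : ℝ)| * |(x : ℝ)| ≤ 1) :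
    ∀ τ : Tau S.n, tauNorm τ ≤ N → ‖S.archF R v B pv τ (x : ℂ)‖ ≤
      (B.card * P * W * Real.exp (Lmax * |(x : ℝ)|) * (2 * (V₀ * |S.Λ / (S.b S.j₀ : ℝ)| * |(x : ℝ)|))) * env 1 Γ τ := by
  intro τ hτ
  have ht₀ : τ.1 ≤ N := by unfold tauNorm at hτ; omega
  have h := S.norm_archF_sub_archφ_le_intCast R v B pv τ x hP (fun i hi => hW i hi τ.1 ht₀) hΓ hL hV₀ hsmall
  rw [hvan τ hτ, Rat.cast_zero, sub_zero] at h
  refine h.trans (le_of_eq ?_)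
  simp only [env, one_pow, one_mul]
  ring

end ArchG3Setup

end Summit.ABC.StewartYu

end
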